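import Summits.QuantumFields.BalabanUV.Beta.RelInvBorderedHessian
import Summits.QuantumFields.BalabanUV.Beta.KernelWardRelative
import Literature.MathematicalPhysics.QuantumFieldTheory.Balaban1983to89.Beta.AveragingWardStencils

/-!
# `BalabanUV.Beta.KernelWardHColumn` — binder row D1, the WARD binder `hW`, leaf (W-LH)₀: THE ℋ-COLUMN WARD LAW AT `j = 0`,
# DERIVED from rule AME of the relative inverse against the STRAIGHT bordered Hessian, with the constant `cH 0 = (Lc^{d+1})⁻¹` COMPUTED

HONEST FRAMING (cell contract, verbatim): «discharging `BetaPertH` makes Bałaban's UV stability UNCONDITIONAL — a real constructive-QFT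
result; it is NOT the continuum limit and NOT the Clay problem.»  DERIVED cell leaf (pub-balaban β sub-cell, D1 formalisation swarm, seat
`b2b-balaban-beta-d1-formalise-leaf-07`; leaf (W-LH)₀ of an1-g25's `HOME/b2b-balaban-beta-an1-g25/SKELETON-D1-hW.v1.md` f7b1b0e3d79e0009 §2).
No statement of Bałaban's papers is typed here, no `[cite:]` tag, no `def`, no `Prop` fact; it instantiates no binder of the β-function wall by
itself: it supplies the `j = 0` instance of the socket `hH` of `KernelWardRelativeEnd.wardTransversal_flipK_TbalOf_JsBalBmNAtOf_ctrC(_parity)`,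
one of four leaves of `hW`, itself one of four binders of `OneStepKernelFamily.d1Drift_of_D1Tel_D1Rep`.  NOT `BetaPertH`; NOT continuum; NOT Clay.
HONEST DEPENDENCY (verbatim): continuum YM on T⁴ ⇐ BetaPertH ∧ nine spine estimates (0/9 proved); BetaPertH ⇐ (D1) ∧ (D4) ∧ CAP+tail;
G-an2-4 gates asym, D1 and NE2/3/4.

## What is here ([folklore] kernel bookkeeping; «not in print; our proof attempt»)

The socket `hH` of the hW root reads, at step `j`: `Σ_μ (colH G_j Lc μ (y − e_μ) κ′ u − colH G_j Lc μ y κ′ u) = cH j · gaugeWt Lc y κ′ u`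
(«the coarse divergence, in the multiplier leg, of the field–multiplier block of `G_j` is the fine pure-gauge mode of the block»).
THIS FILE proves it at `j = 0` for EVERY packed kernel `G` that is spread and satisfies rule AME of
`ChartConjugationRelative.RelInv` against the STRAIGHT bordered Hessian `bhK N = [[d*d, −𝒬ᵀ_N],[𝒬_N, 0]]` and the coarse axial
coordinate projector `axEc ρ N` (ANY offset `ρ`), with the constant DERIVED: **`cH = (N^{d+1})⁻¹ = |box (d+1) N|⁻¹`**.
Mechanism (an1's (W-LH) derivation, run on the straight operator, whose `j = 0` relative inverse is in the tree as
`BorderedHessian.relInv_coDressKBmAt_KInvStep_zero`): contract `(G ∘ 𝕄) ∘ E = E` on the right with the finitely supported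
PURE-GAUGE TEST KERNEL whose single non-zero column is `(dz 1_{B(y)} ; 0)` —
* `E` fixes it (`comp_axEc_apply`: a comb bond never crosses a block boundary — the second clause of `IsCombBondAt`; the
  multiplier rows of the test kernel vanish);
* `bhK N` maps it to `(d*d dz 1_B − 𝒬ᵀ 0 ; 𝒬_N dz 1_{B(y)}) = (0 ; dz (blockSum 1_{B(y)})) = (0 ; N^{d+1}·(δ_{y−e_κ} − δ_y))`
  (`BorderedHessianKernelAction.comp_bhK_inl/_inr`, `AffineAveraging.curv_dz`, `contourSum_dz`, `AveragingContours.blk_block`);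
* reading the field row `(u, inl κ′)` of `G ∘ (that) = test kernel` (`ResolventComposition.tsum_sublattice₀`) gives
  `N^{d+1} · Σ_μ (colH G N μ (y − e_μ) κ′ u − colH G N μ y κ′ u) = gaugeWt N y κ′ u`.
Contents: §1 three helpers (`loc_of_bdd_support`, `l1_sub_zsmul_le_of_blk`, `blockSum_blockInd`); §2 the generic law
**`colH_ward_of_AME`**; §3 the instance **`colH_ward_KInvStep_zero`** for `G₀ := coDressKBmAt (toSite r) Lc (KInvStep Lc 0)`, every
in-block root `r`, every `d`, every `Lc ≥ 1` — the `j = 0` instance of `hH` with `cH 0 = ((Lc : ℝ)^(d+1))⁻¹` (at `d = 3`: `Lc⁻⁴`, as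
an1's skeleton predicts).  `j ≥ 1` (the step candidate `bhKStep`, border scale `stepScale`) is NOT here.
All declarations `[folklore]`; axioms standard.  Provenance: b2b-balaban β sub-cell, D1 formalisation swarm leaf-07, 2026-08-20 (v1); over
`RelInvBorderedHessian` (an2 gen 13), `BorderedHessianKernelAction` (an2), `AxialCoordinateProjectorCoarse` (an2), `KernelWardRelative`
(an1 gen 25, `gaugeWt`), `AveragingWardStencils` (an1, `b6UnitVec_eq`) BY NAME; no existing file touched.
-/

open Finset Filter
open scoped BigOperators
open Literature.Probability.LatticeModels (TorusSite Torus.proj Torus.proj_apply)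
open Literature.MathematicalPhysics.QuantumFieldTheory
open Literature.MathematicalPhysics.QuantumFieldTheory.Balaban1983to89
open Literature.MathematicalPhysics.QuantumFieldTheory.Balaban1983to89.Beta
open B12Sec2to5 (l1 l1_nonneg)
open ExpKernelCalculus (MKer Decays BiLoc comp)
open AffineAveraging (Form0 Form1 Form2 box toSite dz curv curvAdj contourSum blockSum curv_dz contourSum_dz)
open AffineReproduction (contourSumAdj)
open AveragingContours (blk blk_block)
open AveragingWardStencils (b6UnitVec_eq)
open LatticeForm (quo)
open OneStepResolventKernel (Fib KInv quo_zsmul proj_zsmul)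
open OneStepKernelFamily (KInvStep colH decays_KInvStep)
open AxialProjector (zsmul_blk_le lt_zsmul_blk_add)
open ResolventComposition (tsum_sublattice₀)
open Summit.QuantumFields.BalabanUV.Beta.TameKernelCalculus
open Summit.QuantumFields.BalabanUV.Beta.ChartConjugationRelative (RelInv)
open Summit.QuantumFields.BalabanUV.Beta.AxialDressingRooted (IsCombBondAt axEc comp_axEc_apply spr_axEc spr_comp coDressKBmAt spr_coDressKBmAt
  one_le_of_neZero)
open Summit.QuantumFields.BalabanUV.Beta.BorderedHessian (bhK spr_bhK fcol mcol fcol_apply mcol_apply comp_bhK_inl comp_bhK_inr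
  relInv_coDressKBmAt_KInvStep_zero)
open Summit.QuantumFields.BalabanUV.Beta.KernelWardRelative (gaugeWt)

namespace Summit.QuantumFields.BalabanUV.Beta.KernelWardHColumn

noncomputable section

variable {d : ℕ}

/-! ## §1 Two tame-currency helpers -/

/-- [folklore] A BOUNDED kernel with BOUNDED SUPPORT (in `l1`-distance from a pair of base points) is localised. -/
theorem loc_of_bdd_support {K : MKer (d + 1) (Fib d)} (p q : Fin (d + 1) → ℤ) {B R : ℝ} (hB : ∀ z z' a b, |K z z' a b| ≤ B)
    (hsupp : ∀ z z' a b, K z z' a b ≠ 0 → l1 (z - p) + l1 (z' - q) ≤ R) : Loc K := by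
  have hB0 : 0 ≤ B := (abs_nonneg _).trans (hB p q (Sum.inr 0) (Sum.inr 0))
  refine ⟨p, q, B * Real.exp R, 1, one_pos, fun z z' a b => ?_⟩
  by_cases h0 : K z z' a b = 0
  · rw [h0, abs_zero]; positivity
  · have hR := hsupp z z' a b h0
    have h1 : Real.exp R * Real.exp (-1 * (l1 (z - p) + l1 (z' - q))) ≥ 1 := by
      rw [← Real.exp_add]
      exact Real.one_le_exp (by linarith)
    calc |K z z' a b| ≤ B := hB z z' a b
      _ = B * 1 := (mul_one B).symm
      _ ≤ B * (Real.exp R * Real.exp (-1 * (l1 (z - p) + l1 (z' - q)))) := mul_le_mul_of_nonneg_left h1 hB0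
      _ = B * Real.exp R * Real.exp (-1 * (l1 (z - p) + l1 (z' - q))) := by ring

/-- [folklore] A fine site `z` whose block — or the block of whose neighbour `z + e_κ` — has coarse label `y` is within `l1`-distance
`(d+1)·N` of `N•y` (every coordinate of `z − N•y` lies in `[−1, N)`). -/
theorem l1_sub_zsmul_le_of_blk {N : ℕ} (hN : 1 ≤ N) {z y : Fin (d + 1) → ℤ} {κ : Fin (d + 1)}
    (h : blk N z = y ∨ blk N (z + AffineAveraging.unitVec κ) = y) : l1 (z - (N : ℤ) • y) ≤ (d + 1 : ℝ) * N := by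
  unfold l1
  have key : ∀ i, -1 ≤ (z - (N : ℤ) • y) i ∧ (z - (N : ℤ) • y) i < N := by
    intro i
    rcases h with h | h
    · have h1 := zsmul_blk_le hN z i
      have h2 := lt_zsmul_blk_add hN z i
      rw [h] at h1 h2
      simp only [Pi.sub_apply]
      constructor <;> omega
    · have h1 := zsmul_blk_le hN (z + AffineAveraging.unitVec κ) i
      have h2 := lt_zsmul_blk_add hN (z + AffineAveraging.unitVec κ) i
      rw [h] at h1 h2
      simp only [Pi.add_apply, AffineAveraging.unitVec_apply] at h1 h2
      simp only [Pi.sub_apply]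
      by_cases hi : i = κ
      · rw [if_pos hi] at h1 h2; constructor <;> omega
      · rw [if_neg hi] at h1 h2; constructor <;> omega
  have hle : ∀ i, |(((z - (N : ℤ) • y) i : ℤ) : ℝ)| ≤ (N : ℝ) := by
    intro i
    obtain ⟨h1, h2⟩ := key i
    rw [abs_le]
    constructor
    · have h1' : (-1 : ℝ) ≤ (((z - (N : ℤ) • y) i : ℤ) : ℝ) := by exact_mod_cast h1
      have hN' : (1 : ℝ) ≤ (N : ℝ) := by exact_mod_cast hN
      linarith
    · exact_mod_cast h2.le
  calc ∑ i, |(((z - (N : ℤ) • y) i : ℤ) : ℝ)| ≤ ∑ _i : Fin (d + 1), (N : ℝ) := Finset.sum_le_sum fun i _ => hle i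
    _ = (d + 1 : ℝ) * N := by rw [Finset.sum_const, Finset.card_univ, Fintype.card_fin, nsmul_eq_mul]; push_cast; ring

/-- [folklore] The block sum of the indicator of block `y` is `N^{d+1}·δ_y`. -/
theorem blockSum_blockInd {N : ℕ} (y q : Fin (d + 1) → ℤ) :
    blockSum N (fun v : Fin (d + 1) → ℤ => if blk N v = y then (1 : ℝ) else 0) q = if q = y then (N : ℝ) ^ (d + 1) else 0 := by
  unfold blockSum
  have hcard : (box (d + 1) N).card = N ^ (d + 1) := by
    unfold AffineAveraging.box
    rw [Fintype.card_piFinset, Finset.prod_const, Finset.card_range, Finset.card_univ, Fintype.card_fin]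
  have e : ∀ b ∈ box (d + 1) N, (if blk N ((N : ℤ) • q + toSite b) = y then (1 : ℝ) else 0) = if q = y then 1 else 0 := by
    intro b hb; rw [blk_block q hb]
  rw [Finset.sum_congr rfl e, Finset.sum_const, hcard, nsmul_eq_mul]
  push_cast
  split_ifs <;> simp

/-! ## §2 The generic ℋ-column Ward law from rule AME against the straight bordered Hessian -/

section Generic

variable {N : ℕ} [NeZero N] {ρ : Fin (d + 1) → ℤ} {G : MKer (d + 1) (Fib d)}

open Classical in
/-- [folklore] **THE ℋ-COLUMN WARD LAW FROM RULE AME** (an1's (W-LH) derivation, straight operator, constant derived): if `G` is spread and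
`(G ∘ bhK N) ∘ axEc ρ N = axEc ρ N`, then for every coarse label `y` and fine leg `(u, κ′)`:
`Σ_μ (colH G N μ (y − e_μ) κ′ u − colH G N μ y κ′ u) = (N^{d+1})⁻¹ · gaugeWt N y κ′ u`. -/
theorem colH_ward_of_AME (hG : Spr G) (hAME : comp (comp G (bhK N)) (axEc ρ N) = axEc ρ N) (y : Fin (d + 1) → ℤ) (κ' : Fin (d + 1))
    (u : Fin (d + 1) → ℤ) :
    ∑ μ, (colH G N μ (y - B6BondElimination.unitVec μ) κ' u - colH G N μ y κ' u) = ((N : ℝ) ^ (d + 1))⁻¹ * gaugeWt N y κ' u := by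
  have hN : 1 ≤ N := one_le_of_neZero N
  have hN0 : ((N : ℝ) ^ (d + 1)) ≠ 0 := pow_ne_zero _ (by exact_mod_cast (NeZero.ne N))
  -- the block indicator of coarse label `y` and the pure-gauge test kernel (single non-zero column `(0, inl 0)`)
  set bI : Form0 (d + 1) ℝ := fun v => if blk N v = y then 1 else 0 with hbI
  set T : MKer (d + 1) (Fib d) := fun z z' f b =>
    if z' = 0 ∧ b = Sum.inl 0 then (match f with | Sum.inl κ => bI (z + AffineAveraging.unitVec κ) - bI z | Sum.inr _ => 0) else 0 with hT
  have hT_inl : ∀ z z' κ b, T z z' (Sum.inl κ) b = if z' = 0 ∧ b = Sum.inl 0 then bI (z + AffineAveraging.unitVec κ) - bI z else 0 :=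
    fun z z' κ b => rfl
  have hT_inr : ∀ z z' m b, T z z' (Sum.inr m) b = 0 := by
    intro z z' m b; simp only [hT]; split_ifs <;> rfl
  have hbI_le : ∀ v, |bI v| ≤ 1 := by
    intro v; simp only [hbI]; split_ifs <;> simp
  -- (a) `T` is localised, hence tame
  have hTloc : Loc T := by
    refine loc_of_bdd_support ((N : ℤ) • y) 0 (B := 2) (R := (d + 1 : ℝ) * N) (fun z z' a b => ?_) (fun z z' a b hne => ?_)
    · rcases a with κ | m
      · rw [hT_inl z z' κ b]
        split_ifs
        · exact (abs_sub _ _).trans (by linarith [hbI_le (z + AffineAveraging.unitVec κ), hbI_le z])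
        · norm_num
      · rw [hT_inr z z' m b, abs_zero]; norm_num
    · rcases a with κ | m
      · rw [hT_inl z z' κ b] at hne
        by_cases hc : z' = 0 ∧ b = Sum.inl 0
        · rw [if_pos hc] at hne
          have hl0 : l1 (z' - 0 : Fin (d + 1) → ℤ) = 0 := by rw [hc.1]; simp [l1]
          rw [hl0, add_zero]
          have hor : blk N z = y ∨ blk N (z + AffineAveraging.unitVec κ) = y := by
            by_contra hno
            have hn1 : ¬ blk N z = y := fun h => hno (Or.inl h)
            have hn2 : ¬ blk N (z + AffineAveraging.unitVec κ) = y := fun h => hno (Or.inr h)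
            apply hne
            simp only [hbI, if_neg hn1, if_neg hn2, sub_self]
          exact l1_sub_zsmul_le_of_blk hN hor
        · rw [if_neg hc] at hne; exact absurd rfl hne
      · rw [hT_inr z z' m b] at hne; exact absurd rfl hne
  -- (b) `axEc` fixes `T`: a comb bond never crosses a block boundary; multiplier rows of `T` vanish
  have hET : comp (axEc ρ N) T = T := by
    funext z z' a b
    rw [comp_axEc_apply]
    rcases a with α | m
    · simp only
      split_ifs with hcomb
      · rw [hT_inl z z' α b]
        split_ifs
        · simp only [hbI]
          rw [hcomb.2, sub_self]
        · rfl
      · rfl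
    · simp only
      rw [hT_inr z z' m b]; split_ifs <;> rfl
  -- (c) the action of the straight bordered Hessian on `T`: column `(0, inl 0)`
  have hfcol : fcol T 0 (Sum.inl 0) = dz bI := by
    funext l v
    rw [fcol_apply, hT_inl v 0 l (Sum.inl 0), if_pos ⟨rfl, rfl⟩]
    rfl
  have hmcol : mcol N T 0 (Sum.inl 0) = 0 := by
    funext l v
    rw [mcol_apply, hT_inr ((N : ℤ) • v) 0 l (Sum.inl 0)]
    rfl
  have hM_inl : ∀ t l, comp (bhK N) T t 0 (Sum.inl l) (Sum.inl 0) = 0 := by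
    intro t l
    rw [comp_bhK_inl, hfcol, hmcol, curv_dz]
    simp [curvAdj, contourSumAdj]
  have hM_inr : ∀ t m, comp (bhK N) T t 0 (Sum.inr m) (Sum.inl 0) =
      if Torus.proj N t = 0 then
        ((if quo N t + AffineAveraging.unitVec m = y then (N : ℝ) ^ (d + 1) else 0) - (if quo N t = y then (N : ℝ) ^ (d + 1) else 0))
      else 0 := by
    intro t m
    rw [comp_bhK_inr, hfcol, contourSum_dz]
    by_cases ht : Torus.proj N t = 0
    · rw [if_pos ht, if_pos ht]
      simp only [dz]
      rw [hbI, blockSum_blockInd, blockSum_blockInd]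
    · rw [if_neg ht, if_neg ht]
  -- (d) contract rule AME with `T` and reassociate
  have hM : Spr (bhK (d := d) N) := spr_bhK hN
  have hE : Spr (axEc ρ N) := spr_axEc _ _
  have h1 : comp (comp (comp G (bhK N)) (axEc ρ N)) T = T := by rw [hAME, hET]
  rw [← comp_assoc_tame (spr_comp hG hM).tame hE.tame hTloc.tame, hET, ← comp_assoc_tame hG.tame hM.tame hTloc.tame] at h1
  -- (e) read the entry `(u, 0, inl κ′, inl 0)`
  have h2 := congrFun (congrFun (congrFun (congrFun h1 u) 0) (Sum.inl κ')) (Sum.inl 0)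
  -- the right-hand side is the pure-gauge weight
  have hR : T u 0 (Sum.inl κ') (Sum.inl 0) = gaugeWt N y κ' u := by
    rw [hT_inl u 0 κ' (Sum.inl 0), if_pos ⟨rfl, rfl⟩]
    simp only [hbI, gaugeWt, b6UnitVec_eq]
  -- the left-hand side: only the coarse multiplier legs of `G` see the (non-zero part of the) image
  set c : (Fin (d + 1) → ℤ) → ℝ := fun q => if q = y then (N : ℝ) ^ (d + 1) else 0 with hc
  have hL : comp G (comp (bhK N) T) u 0 (Sum.inl κ') (Sum.inl 0) =
      ∑' q : Fin (d + 1) → ℤ, ∑ m : Fin (d + 1), G u ((N : ℤ) • q) (Sum.inl κ') (Sum.inr m) * (c (q + AffineAveraging.unitVec m) - c q) := by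
    show (∑' t, ∑ g : Fib d, G u t (Sum.inl κ') g * comp (bhK N) T t 0 g (Sum.inl 0)) = _
    refine tsum_sublattice₀ N _ _ (fun t ht => ?_) (fun q => ?_)
    · rw [Fintype.sum_sum_type]
      simp only [hM_inl, hM_inr, if_neg ht, mul_zero, Finset.sum_const_zero, zero_add]
    · have hq : Torus.proj N ((N : ℤ) • q) = 0 := proj_zsmul q
      rw [Fintype.sum_sum_type]
      simp only [hM_inl, hM_inr, if_pos hq, quo_zsmul, mul_zero, Finset.sum_const_zero, zero_add, hc]
  -- evaluate the finitely supported coarse sum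
  have hS : ∑' q : Fin (d + 1) → ℤ, ∑ m : Fin (d + 1), G u ((N : ℤ) • q) (Sum.inl κ') (Sum.inr m) * (c (q + AffineAveraging.unitVec m) - c q) =
      (N : ℝ) ^ (d + 1) * ∑ m, (colH G N m (y - B6BondElimination.unitVec m) κ' u - colH G N m y κ' u) := by
    set S : Finset (Fin (d + 1) → ℤ) := insert y (Finset.univ.image fun m : Fin (d + 1) => y - AffineAveraging.unitVec m) with hSdef
    have hyS : y ∈ S := Finset.mem_insert_self _ _
    have hymS : ∀ m, y - AffineAveraging.unitVec m ∈ S := fun m =>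
      Finset.mem_insert_of_mem (Finset.mem_image.2 ⟨m, Finset.mem_univ _, rfl⟩)
    rw [tsum_eq_sum (s := S)]
    · -- swap the two finite sums and evaluate the indicators
      rw [Finset.sum_comm, Finset.mul_sum]
      refine Finset.sum_congr rfl fun m _ => ?_
      have e1 : ∀ q, c (q + AffineAveraging.unitVec m) = if q = y - AffineAveraging.unitVec m then (N : ℝ) ^ (d + 1) else 0 := by
        intro q
        simp only [hc]
        by_cases hq : q = y - AffineAveraging.unitVec m
        · rw [if_pos (by rw [hq]; abel), if_pos hq]
        · rw [if_neg (fun h => hq (by rw [← h]; abel)), if_neg hq]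
      have e2 : ∀ q, G u ((N : ℤ) • q) (Sum.inl κ') (Sum.inr m) * (c (q + AffineAveraging.unitVec m) - c q) =
          (if q = y - AffineAveraging.unitVec m then G u ((N : ℤ) • q) (Sum.inl κ') (Sum.inr m) * (N : ℝ) ^ (d + 1) else 0) -
            (if q = y then G u ((N : ℤ) • q) (Sum.inl κ') (Sum.inr m) * (N : ℝ) ^ (d + 1) else 0) := by
        intro q
        rw [e1]
        simp only [hc]
        split_ifs <;> ring
      rw [Finset.sum_congr rfl (fun q _ => e2 q), Finset.sum_sub_distrib, Finset.sum_ite_eq' S (y - AffineAveraging.unitVec m),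
        Finset.sum_ite_eq' S y, if_pos (hymS m), if_pos hyS]
      simp only [colH, b6UnitVec_eq]
      ring
    · intro q hq
      refine Finset.sum_eq_zero fun m _ => ?_
      have hqy : q ≠ y := fun h => hq (h ▸ hyS)
      have hqm : q + AffineAveraging.unitVec m ≠ y := by
        intro h
        apply hq
        have : q = y - AffineAveraging.unitVec m := by rw [← h]; abel
        rw [this]; exact hymS m
      simp only [hc, if_neg hqy, if_neg hqm, sub_self, mul_zero]
  -- assemble
  rw [hL, hS, hR] at h2
  -- `N^{d+1} · Σ = gaugeWt` ⇒ `Σ = (N^{d+1})⁻¹ · gaugeWt`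
  rw [← h2, ← mul_assoc, inv_mul_cancel₀ hN0, one_mul]

end Generic

/-! ## §3 The instance `j = 0`: the block-mean co-dressed first-step resolvent -/

section StepZero

variable {Lc : ℕ} [NeZero Lc] {r : Fin (d + 1) → ℕ}

/-- [folklore] The decimated composite resolvent at `j = 0` is spread (`OneStepKernelFamily.decays_KInvStep`). -/
theorem spr_KInvStep_zero : Spr (KInvStep (d := d) Lc 0) := by
  obtain ⟨δ, C, hδ, -, h⟩ := decays_KInvStep (d := d) (Lc := Lc) 0
  exact ⟨C, δ, hδ, h⟩

/-- [folklore] **(W-LH)₀ — THE ℋ-COLUMN WARD LAW AT `j = 0` WITH ITS CONSTANT**: for every in-block root `r` and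
`G₀ := coDressKBmAt (toSite r) Lc (KInvStep Lc 0)` (the Π_bm-co-dressed first-step resolvent of the wall family),
`Σ_μ (colH G₀ Lc μ (y − e_μ) κ′ u − colH G₀ Lc μ y κ′ u) = ((Lc : ℝ)^(d+1))⁻¹ · gaugeWt Lc y κ′ u` — the `j = 0` instance of the socket `hH`
of `KernelWardRelativeEnd.wardTransversal_flipK_TbalOf_JsBalBmNAtOf_ctrC(_parity)` with `cH 0 = Lc^{−(d+1)}` (rule AME from
`BorderedHessian.relInv_coDressKBmAt_KInvStep_zero`). -/
theorem colH_ward_KInvStep_zero (hr : r ∈ box (d + 1) Lc) (y : Fin (d + 1) → ℤ) (κ' : Fin (d + 1)) (u : Fin (d + 1) → ℤ) :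
    ∑ μ, (colH (coDressKBmAt (toSite r) Lc (KInvStep (d := d) Lc 0)) Lc μ (y - B6BondElimination.unitVec μ) κ' u
        - colH (coDressKBmAt (toSite r) Lc (KInvStep (d := d) Lc 0)) Lc μ y κ' u) =
      ((Lc : ℝ) ^ (d + 1))⁻¹ * gaugeWt Lc y κ' u :=
  colH_ward_of_AME (spr_coDressKBmAt (one_le_of_neZero Lc) hr spr_KInvStep_zero) (relInv_coDressKBmAt_KInvStep_zero hr).AME y κ' u

end StepZero

end

end Summit.QuantumFields.BalabanUV.Beta.KernelWardHColumn
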